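import Mathlib
import Summits.CriticalPhenomena.SAWScalingLimit.Theses.SAWTotalPositivity
import Literature.Probability.RandomPlanarGeometry.SAWCount
import Literature.Probability.RandomPlanarGeometry.BDGS2012

/-!
# Sketch — first lemmas of the crux-idea cards for `CriticalBubbleBound`
(crux stmt-CriticalPhenomena-7117, route SAWTotalPositivity; ideator 3, round 1)

Nothing here is proved; the point is that the signatures elaborate over existing declarations.
-/

noncomputable section

open scoped BigOperators ENNReal
open Literature.Probability.LatticeModels Literature.Probability.RandomPlanarGeometry

namespace Summit.CriticalPhenomena.SAWScalingLimit.Cruxes.CriticalBubbleBound.Sketch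

/-- The unit vectors of `ℤ²`. -/
def e₁ : Site 2 := ![1, 0]
def e₂ : Site 2 := ![0, 1]

/-! ## (R) Counting reformulation shared by every card
`CriticalBubbleBound` ⟺ the ROOTED critical polygon mass `Σ_n c_n(0,e₁) x_c^n` is finite
(monotone exhaustion of `ℤ²` by bounded domains; `c_n(0,e₁)` = `SAW.Zd.countAt 2 n e₁`). -/

/-- Rooted critical polygon mass `G• = Σ_n c_n(0,e₁) x_c^n` in `[0,∞]`. -/
def rootedMass : ℝ≥0∞ :=
  ∑' n : ℕ, (SAW.Zd.countAt 2 n e₁ : ℝ≥0∞) * ENNReal.ofReal (SAW.criticalFugacity ^ n)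

/-- (R) The crux is the finiteness of the rooted mass. -/
theorem criticalBubbleBound_iff_rootedMass_ne_top :
    Summit.CriticalPhenomena.SAWScalingLimit.Theses.SAWTotalPositivity.CriticalBubbleBound ↔
      rootedMass ≠ ⊤ := by
  sorry

/-! ## Card `contact-set-joining`: the docking-translation set of two finite lattice sets -/

/-- Minkowski difference `A ⊖ B = {a - b}`: the translations `v` for which `B + v` meets `A`. -/
def minkDiff (A B : Finset (Site 2)) : Finset (Site 2) :=
  (A ×ˢ B).image fun p => p.1 - p.2

/-- Docking (contact) translations: `B + v` is disjoint from `A` but at lattice distance `1`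
from it. This is the two-parameter family of join locations (Madras/Hammond use only the
vertical pushes). -/
def cont (A B : Finset (Site 2)) : Finset (Site 2) :=
  ((minkDiff A B).biUnion fun v => ({v + e₁, v - e₁, v + e₂, v - e₂} : Finset (Site 2))) \
    minkDiff A B

/-- Semantics of `cont`. -/
theorem mem_cont_iff (A B : Finset (Site 2)) (v : Site 2) :
    v ∈ cont A B ↔
      Disjoint A (B.image fun b => b + v) ∧ ∃ a ∈ A, ∃ b ∈ B, (zdGraph 2).Adj a (b + v) := by
  sorry

/-- FIRST LEMMA (push lemma, provable now): the docking set is at least as large as the sum of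
the widths and heights — pushes from the four axis directions at every overlapping offset give
distinct docking translations. Stated for arbitrary witnesses of the extents (the extreme
witnesses give width/height). Hammond's `(n-j)^{1/2}` in Prop. 4.2 of arXiv:1808.09032 is the
vertical half of this bound for polygons of height `≥ √n`. -/
theorem extents_le_card_cont (A B : Finset (Site 2))
    {a₁ a₂ a₃ a₄ b₁ b₂ b₃ b₄ : Site 2}
    (ha₁ : a₁ ∈ A) (ha₂ : a₂ ∈ A) (ha₃ : a₃ ∈ A) (ha₄ : a₄ ∈ A)
    (hb₁ : b₁ ∈ B) (hb₂ : b₂ ∈ B) (hb₃ : b₃ ∈ B) (hb₄ : b₄ ∈ B) :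
    ((a₂ 0 - a₁ 0) + (b₂ 0 - b₁ 0) + 1) + ((a₄ 1 - a₃ 1) + (b₄ 1 - b₃ 1) + 1)
      ≤ ((cont A B).card : ℤ) := by
  sorry

/-! ## Card `contact-set-joining`: pattern-root normalisation (Kesten for polygons)
A rooted polygon through the edge `{0, e₁}` is an `n`-step SAW `ω ∈ sawFun 2 n e₁` (from `0` to
`e₁`, `n ≥ 3`). The FRAME pattern `π_m` at the root: the polygon runs straight through the root
for `m` steps on either side and the box `[-m, m+1] × [-m, m]` is otherwise empty. -/

/-- The frame pattern of size `m` occurs at the root of the rooted polygon `ω` (an `n`-step SAW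
from `0` to `e₁`): `ω` leaves `0` to the left along the axis for `m` steps, arrives at `e₁` from
the right along the axis for `m` steps, and visits no other site of the box
`[-m, m+1] × [-m, m]`. -/
def FrameAtRoot (m n : ℕ) (ω : ℕ → Site 2) : Prop :=
  (∀ j ≤ m, ω j = -((j : ℤ) • e₁)) ∧ (∀ j ≤ m, ω (n - j) = e₁ + (j : ℤ) • e₁) ∧
    ∀ i, m < i → i < n - m → ¬ (|ω i 0| ≤ m + 1 ∧ |ω i 1| ≤ m)

open Classical in
/-- Rooted mass restricted to roots carrying the frame pattern `π_m`. -/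
def framedRootedMass (m : ℕ) : ℝ≥0∞ :=
  ∑' n : ℕ, (((SAW.Zd.sawFun 2 n e₁).filter fun ω => FrameAtRoot m n ω).card : ℝ≥0∞) *
    ENNReal.ofReal (SAW.criticalFugacity ^ n)

/-- PATTERN-ROOT NORMALISATION (Kesten's pattern theorem for polygons + cyclic re-rooting): for
every frame size `m` there are `a > 0` and `C < ∞` with `G• ≤ C + a⁻¹ · G•[π_m at the root]`.
Hence the crux is equivalent to the finiteness of the framed rooted mass: WLOG the root sits in
the middle of a straight run of length `2m+1` with an empty `m`-box around it. -/
theorem rootedMass_le_framed (m : ℕ) :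
    ∃ a C : ℝ≥0∞, a ≠ 0 ∧ C ≠ ⊤ ∧ rootedMass ≤ C + a⁻¹ * framedRootedMass m := by
  sorry

/-! ## Card `contact-set-joining`: the exponent criterion as a typed conjecture
LINEAR CONTACT (κ' ≥ 1 in mass-average): docking translations of a rooted polygon against
partners of comparable length are at least proportional to its length, on x_c-average. -/

open Classical in
/-- `q_m` = number of `m`-step rooted polygons = `c_m(0,e₁)`; the vertex set of `ω ∈ sawFun`. -/
def verts (n : ℕ) (ω : ℕ → Site 2) : Finset (Site 2) := (Finset.range (n + 1)).image ω

open Classical in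
/-- LinearContact: `∃ c > 0, ∀ n` large, `Σ_{ω ∈ c_n(0,e₁)} Σ_{ω' ∈ c_n(0,e₁)} |cont(ω, ω')|
≥ c · n · c_n(0,e₁)²` — the two-parameter joining entropy is at least LINEAR in the length
(Hammond's one-parameter family gives `n^{1/2}`). With unjoin sparsity and Kesten's rate
(MS93 (7.5.2)) this is what turns `θ ≥ 3/2` into `θ > 2`, i.e. the crux. -/
def LinearContact : Prop :=
  ∃ c : ℝ, 0 < c ∧ ∃ n₀ : ℕ, ∀ n ≥ n₀,
    c * n * ((SAW.Zd.sawFun 2 n e₁).card : ℝ) ^ 2 ≤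
      ∑ ω ∈ SAW.Zd.sawFun 2 n e₁, ∑ ω' ∈ SAW.Zd.sawFun 2 n e₁,
        ((cont (verts n ω) (verts n ω')).card : ℝ)

end Summit.CriticalPhenomena.SAWScalingLimit.Cruxes.CriticalBubbleBound.Sketch
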